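import Summits.RiemannHypothesis.RiemannHypothesis.Theorems.ThetaTier1BridgeMain
import HarnessLib

/-!
# THETA tier-2 — the CONSTANTS `ζ(6)`, `ζ(5)`, `Σ Λ(n) n⁻⁶` against the checker's stand-ins (`m = 5`; seat tier2-p1, cc-s2-1 lane §6(e);
RH-FREE bookkeeping)

Every tier-2 row has B-spline order `m = 5` (TIER2-KERNEL-SPEC §4), so the atoms layer (`ThetaTier2Atoms`, stand-ins `zetaHi 6 = 1.0174`,
`zetaHi 5 = 1.0370`, `pLamHi 6 = 1/64` of tier 1) needs tier 1's named hypotheses at `m = 5`: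

* `zetaTail_six_le : Σ_{n≥1} n⁻⁶ ≤ 1.0174` — four exact terms, tail `Σ_{n≥5} n⁻⁶ ≤ (1/25)(π⁴/90 − Σ_{n≤4} n⁻⁴)` (the `ζ(4)` identity of
  `ThetaTier1Constants`);
* `vonMangoldtSum_six_le : Σ Λ(n) n⁻⁶ ≤ 1/64` — termwise `Λ(n) n⁻⁶ ≤ ½·Λ(n) n⁻⁵` (`n ≥ 2`; the terms `n ≤ 1` vanish) and tier 1's `Σ Λ(n) n⁻⁵ ≤ 1/32`;
* `zetaHyp_five : ZetaHyp 5`, `lambdaHyp_five : LambdaHyp 5` (the packaging `ThetaTier1Bridge` consumes).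

Nothing here bears on the truth of RH.
-/

set_option linter.dupNamespace false  -- the mandated namespace repeats `RiemannHypothesis`
set_option autoImplicit false

namespace Summit.RiemannHypothesis.RiemannHypothesis.Theorems.ThetaTier1

open Summit.RiemannHypothesis.RiemannHypothesis.Theorems.WeilColumn.ThetaMellin
open ArithmeticFunction

/-! ## `ζ(6)` -/

/-- `zeta6_tail_term_le`: `n⁻⁶ ≤ (1/25)·n⁻⁴` for `n ≥ 5` (constants bookkeeping). [this cell] -/
theorem zeta6_tail_term_le (n : ℕ) :
    (1 : ℝ) / ((n + 5 : ℕ) : ℝ) ^ 6 ≤ (1 / 25 : ℝ) * ((1 : ℝ) / ((n + 5 : ℕ) : ℝ) ^ 4) := by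
  have hn : (5 : ℝ) ≤ ((n + 5 : ℕ) : ℝ) := by exact_mod_cast (by omega : 5 ≤ n + 5)
  have hpos : (0 : ℝ) < ((n + 5 : ℕ) : ℝ) := by exact_mod_cast (by omega : 0 < n + 5)
  have h4p : (0 : ℝ) < ((n + 5 : ℕ) : ℝ) ^ 4 := pow_pos hpos 4
  have key : 25 * ((n + 5 : ℕ) : ℝ) ^ 4 ≤ ((n + 5 : ℕ) : ℝ) ^ 6 := by
    have h2 : (25 : ℝ) ≤ ((n + 5 : ℕ) : ℝ) ^ 2 := by nlinarith
    calc 25 * ((n + 5 : ℕ) : ℝ) ^ 4 ≤ ((n + 5 : ℕ) : ℝ) ^ 2 * ((n + 5 : ℕ) : ℝ) ^ 4 :=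
          mul_le_mul_of_nonneg_right h2 h4p.le
      _ = ((n + 5 : ℕ) : ℝ) ^ 6 := by ring
  rw [div_mul_div_comm, one_mul, div_le_div_iff₀ (pow_pos hpos 6) (by linarith)]
  linarith

set_option maxHeartbeats 400000 in
/-- `zeta6_tail_le` (constants bookkeeping). [this cell] -/
theorem zeta6_tail_le :
    ∑' n : ℕ, (1 : ℝ) / ((n + 4 + 1 : ℕ) : ℝ) ^ 6 ≤ (1 / 25 : ℝ) * ∑' n : ℕ, (1 : ℝ) / ((n + 5 : ℕ) : ℝ) ^ 4 := by
  have h4 : Summable (fun n : ℕ => (1 : ℝ) / ((n + 5 : ℕ) : ℝ) ^ 4) :=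
    (summable_nat_add_iff 5).2 (summable_inv_pow' (s := 4) (by norm_num))
  have h4' : Summable (fun n : ℕ => (1 / 25 : ℝ) * ((1 : ℝ) / ((n + 5 : ℕ) : ℝ) ^ 4)) := h4.mul_left _
  have hg' : Summable (fun n : ℕ => (1 : ℝ) / ((n + 5 : ℕ) : ℝ) ^ 6) :=
    (summable_nat_add_iff 5).2 (summable_inv_pow' (s := 6) (by norm_num))
  rw [← h4.tsum_mul_left (1 / 25)]
  have e : (fun n : ℕ => (1 : ℝ) / ((n + 4 + 1 : ℕ) : ℝ) ^ 6) = (fun n : ℕ => (1 : ℝ) / ((n + 5 : ℕ) : ℝ) ^ 6) := by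
    funext n; rw [show n + 4 + 1 = n + 5 by omega]
  rw [e]
  exact Summable.tsum_le_tsum zeta6_tail_term_le hg' h4'

/-- `zeta6_head_le` (constants bookkeeping). [this cell] -/
theorem zeta6_head_le : ∑ i ∈ Finset.range 4, (1 : ℝ) / ((i + 1 : ℕ) : ℝ) ^ 6 ≤ 1.0172414 := by
  norm_num [Finset.sum_range_succ]

/-- `zeta4_head5_ge` (constants bookkeeping). [this cell] -/
theorem zeta4_head5_ge : (1.0787519 : ℝ) ≤ ∑ i ∈ Finset.range 5, (1 : ℝ) / (i : ℝ) ^ 4 := by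
  norm_num [Finset.sum_range_succ]

/-- **`ζ(6)` bound**: `Σ_{n≥1} n⁻⁶ ≤ zetaHi 6 = 1.0174` (true value `π⁶/945 = 1.01734…`). [this cell] -/
theorem zetaTail_six_le : ThetaParams.zetaTail 6 ≤ ((zetaHi 6 : ℚ) : ℝ) := by
  rw [zetaTail_eq_tsum_succ]
  have hg : Summable (fun n : ℕ => (1 : ℝ) / ((n + 1 : ℕ) : ℝ) ^ 6) :=
    (summable_nat_add_iff 1).2 (summable_inv_pow' (s := 6) (by norm_num))
  rw [← hg.sum_add_tsum_nat_add 4]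
  have htail := zeta6_tail_le
  rw [tsum_inv_pow_four_add 5] at htail
  have : ((zetaHi 6 : ℚ) : ℝ) = 1.0174 := by norm_num [zetaHi]
  rw [this]
  linarith [pi_pow_four_div_ninety_lt, htail, zeta6_head_le, zeta4_head5_ge]

/-! ## `Σ Λ(n) n⁻⁶` -/

/-- `Λ(n) n⁻⁶ ≤ ½ Λ(n) n⁻⁵` (the terms `n ≤ 1` vanish, else `n ≥ 2`). [this cell] -/
theorem lam_six_term_le (n : ℕ) : (vonMangoldt n : ℝ) / (n : ℝ) ^ 6 ≤ (1 / 2 : ℝ) * ((vonMangoldt n : ℝ) / (n : ℝ) ^ 5) := by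
  rcases Nat.lt_or_ge n 2 with hn | hn
  · interval_cases n
    · rw [ArithmeticFunction.map_zero]; simp
    · rw [vonMangoldt_apply_one]; simp
  · have hpos : (0 : ℝ) < n := by exact_mod_cast (by omega : 0 < n)
    have h2 : (2 : ℝ) ≤ n := by exact_mod_cast hn
    have hΛ : 0 ≤ (vonMangoldt n : ℝ) := vonMangoldt_nonneg
    rw [div_le_iff₀ (pow_pos hpos 6)]
    have e : (1 / 2 : ℝ) * ((vonMangoldt n : ℝ) / (n : ℝ) ^ 5) * (n : ℝ) ^ 6 = (1 / 2) * (vonMangoldt n : ℝ) * n := by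
      field_simp
    rw [e]
    nlinarith

/-- **`Λ` bound**: `Σ_n Λ(n) n⁻⁶ ≤ pLamHi 6 = 1/64`. [this cell] -/
theorem vonMangoldtSum_six_le : ThetaParams.vonMangoldtSum 6 ≤ ((pLamHi 6 : ℚ) : ℝ) := by
  have hp : ((pLamHi 6 : ℚ) : ℝ) = 1 / 64 := by norm_num [pLamHi]
  rw [hp, ThetaParams.vonMangoldtSum]
  have hs : Summable (fun n : ℕ => (1 / 2 : ℝ) * ((vonMangoldt n : ℝ) / (n : ℝ) ^ 5)) := lam_summable.mul_left _
  have h6 : Summable (fun n : ℕ => (vonMangoldt n : ℝ) / (n : ℝ) ^ 6) :=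
    Summable.of_nonneg_of_le (fun n => div_nonneg vonMangoldt_nonneg (pow_nonneg (Nat.cast_nonneg n) 6)) lam_six_term_le hs
  calc ∑' n : ℕ, (vonMangoldt n : ℝ) / (n : ℝ) ^ 6 ≤ ∑' n : ℕ, (1 / 2 : ℝ) * ((vonMangoldt n : ℝ) / (n : ℝ) ^ 5) :=
        Summable.tsum_le_tsum lam_six_term_le h6 hs
    _ = (1 / 2 : ℝ) * ∑' n : ℕ, (vonMangoldt n : ℝ) / (n : ℝ) ^ 5 := tsum_mul_left
    _ ≤ (1 / 2 : ℝ) * (1 / 32) := mul_le_mul_of_nonneg_left lam_five_le (by norm_num)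
    _ = 1 / 64 := by norm_num

/-! ## The packaging tier 1's bridge consumes -/

/-- **`ZetaHyp 5`**: `ζ(6) ≤ zetaHi 6 ∧ ζ(5) ≤ zetaHi 5`. [this cell] -/
theorem zetaHyp_five : ZetaHyp 5 := ⟨zetaTail_six_le, zetaTail_five_le⟩

/-- **`LambdaHyp 5`**: `Σ Λ(n) n⁻⁶ ≤ pLamHi 6`. [this cell] -/
theorem lambdaHyp_five : LambdaHyp 5 := vonMangoldtSum_six_le

end Summit.RiemannHypothesis.RiemannHypothesis.Theorems.ThetaTier1
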